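import Literature.AnabelianGeometry.Anabelioids.ComponentDecomposition
import Literature.AnabelianGeometry.SemiGraphs.CoveringComparison

/-!
# Decompositions along `𝔾_A` and gluing compatibility ([SemiAnbd] Def. 2.2 (i), global clause — brick G6(b), preparations)

Mochizuki, *Semi-graphs of anabelioids*, Publ. RIMS **42** (2006) 221–322, §2 p. 23
[cite: MochizukiSemiAnbd2006, Def. 2.2(i) p.23].  Tools for the fullness / essential surjectivity of
the comparison functor `toCovering A : B(𝒢)_{/A} ⥤ B(𝒢_A)`:

* `isColimit_cofan_vertices` — for `Y → S_v`, `Y` is the coproduct of the `Y ×_{S_v} P` indexed by the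
  VERTICES `(v, P)` of `𝔾_A` over `v` (the component decomposition of `ComponentDecomposition.lean`,
  re-indexed); `isColimit_cofan_edges` likewise;
* `glue_compat` — a morphism `toCovering X → toCovering Y` in `B(𝒢_A)`, read back on the component
  anabelioids (`preimV`, `preimBr`), is compatible with the pull-back-square gluings `toCoveringGlueApp`.
-/

namespace Literature.AnabelianGeometry.SemiGraphs

open CategoryTheory CategoryTheory.Limits CategoryTheory.PreGaloisCategory
open Literature.AnabelianGeometry.Anabelioids

universe w'' w' w v₁ u₁ u

-- Mathlib's `Over.pullback` / `Over.star` simp lemmas (`pullback.lift_fst`, …) only fire under the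
-- pre-v4.2x defeq transparency behaviour, exactly as in `Mathlib/CategoryTheory/Comma/Over/Pullback.lean`.
set_option backward.isDefEq.respectTransparency false

/-- Re-indexing a coproduct cofan along a bijection of index types. [cite: MochizukiSemiAnbd2006, Def. 2.2(i) p.23] -/
theorem cofan_isColimit_reindex {C : Type u₁} [Category.{v₁} C] {I : Type w} {J : Type w'} (σ : J ≃ I)
    {X : C} {F : I → C} (ι : ∀ i, F i ⟶ X) (hc : IsColimit (Cofan.mk X ι)) :
    Nonempty (IsColimit (Cofan.mk X (fun j => ι (σ j)))) := by
  let e : Discrete J ≌ Discrete I := Discrete.equivalence σ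
  have h1 : IsColimit ((Cofan.mk X ι).whisker e.functor) := hc.whiskerEquivalence e
  let α : Discrete.functor (fun j => F (σ j)) ≅ e.functor ⋙ Discrete.functor F :=
    Discrete.natIso (fun _ => Iso.refl _)
  have h2 : IsColimit ((Cocone.precompose α.hom).obj ((Cofan.mk X ι).whisker e.functor)) :=
    (IsColimit.precomposeHomEquiv α _).symm h1
  refine ⟨IsColimit.ofIsoColimit h2 (Cocone.ext (Iso.refl _) ?_)⟩
  rintro ⟨j⟩
  simp only [α, e, Cofan.mk, Cocone.whisker, Iso.refl_hom, Category.comp_id, Category.id_comp,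
    Cocone.precompose_obj_ι, NatTrans.comp_app, Discrete.natIso_hom_app, Functor.whiskerLeft_app,
    Discrete.natTrans_app]
  rfl

namespace SemiGraphOfAnabelioids

namespace BObj

variable {𝒢 : SemiGraphOfAnabelioids.{v₁, u₁, u}} (A : 𝒢.BObj)

/-! ### Decompositions indexed by the vertices and edges of `𝔾_A` -/

/-- **`Y = ∐_{(v,P)} Y ×_{S_v} P`** over the vertices of `𝔾_A` above `v`, for any `Y → S_v`
(extensivity; re-indexed component decomposition). [cite: MochizukiSemiAnbd2006, Def. 2.2(i) p.23] -/
theorem isColimit_cofan_vertices (v : 𝒢.graph.Vertex) {Y : 𝒢.V v} (f : Y ⟶ A.S v) :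
    Nonempty (IsColimit (Cofan.mk Y
      (fun c : Shrink.{u} (π₀Obj (A.S v)) => pullback.fst f (A.vComp ⟨v, c⟩).1.arrow))) := by
  obtain ⟨hc⟩ := isColimit_cofan_pullback_components f
  exact cofan_isColimit_reindex (equivShrink (π₀Obj (A.S v))).symm _ hc

/-- **`Y = ∐_{(e,Q)} Y ×_{T_e} Q`** over the edges of `𝔾_A` above `e`, for any `Y → T_e`.
[cite: MochizukiSemiAnbd2006, Def. 2.2(i) p.23] -/
theorem isColimit_cofan_edges (e : 𝒢.graph.Edge) {Y : 𝒢.E e} (f : Y ⟶ A.T e) :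
    Nonempty (IsColimit (Cofan.mk Y
      (fun c : Shrink.{u} (π₀Obj (A.T e)) => pullback.fst f (A.eComp ⟨e, c⟩).1.arrow))) := by
  obtain ⟨hc⟩ := isColimit_cofan_pullback_components f
  exact cofan_isColimit_reindex (equivShrink (π₀Obj (A.T e))).symm _ hc

/-! ### Reading a morphism of `B(𝒢_A)` back on the component anabelioids -/

section Preimage

variable {A} {X Y : Over A} (m : A.toCovering.obj X ⟶ A.toCovering.obj Y)

/-- The `(v, P)`-component of `m : toCovering X → toCovering Y`, as a morphism
`X_v ×_{S_v} P → Y_v ×_{S_v} P` over `P` (preimage under the model equivalence).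
[cite: MochizukiSemiAnbd2006, Def. 2.2(i) p.23] -/
noncomputable def preimV (vc : A.fibreData.total.Vertex) : (A.toCoveringV vc).obj X ⟶ (A.toCoveringV vc).obj Y :=
  (Shrink.equivalence (Over ((A.vComp vc).1 : 𝒢.V (A.fibreData.proj.vertexMap vc)))).functor.preimage (m.fS vc)

/-- The model functor maps `preimV` back to the component of `m`. [cite: MochizukiSemiAnbd2006, Def. 2.2(i) p.23] -/
theorem map_preimV (vc : A.fibreData.total.Vertex) :
    (Shrink.equivalence (Over ((A.vComp vc).1 : 𝒢.V (A.fibreData.proj.vertexMap vc)))).functor.map (preimV m vc) =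
      m.fS vc :=
  (Shrink.equivalence (Over ((A.vComp vc).1 : 𝒢.V (A.fibreData.proj.vertexMap vc)))).functor.map_preimage _

/-- The `(e, Q)`-component of `m` as a morphism `X_e ×_{T_e} Q → Y_e ×_{T_e} Q` over `Q`.
[cite: MochizukiSemiAnbd2006, Def. 2.2(i) p.23] -/
noncomputable def preimE (ec : A.fibreData.total.Edge) : (A.toCoveringE ec).obj X ⟶ (A.toCoveringE ec).obj Y :=
  (Shrink.equivalence (Over ((A.eComp ec).1 : 𝒢.E (A.fibreData.proj.edgeMap ec)))).functor.preimage (m.fT ec)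

/-- The model functor maps `preimE` back to the component of `m`. [cite: MochizukiSemiAnbd2006, Def. 2.2(i) p.23] -/
theorem map_preimE (ec : A.fibreData.total.Edge) :
    (Shrink.equivalence (Over ((A.eComp ec).1 : 𝒢.E (A.fibreData.proj.edgeMap ec)))).functor.map (preimE m ec) =
      m.fT ec :=
  (Shrink.equivalence (Over ((A.eComp ec).1 : 𝒢.E (A.fibreData.proj.edgeMap ec)))).functor.map_preimage _

/-- The component of `m` at the edge of a BRANCH `(b, Q)`, over the edge of `b` (definitionally
`preimE m (edgeOf (b, Q))`). [cite: MochizukiSemiAnbd2006, Def. 2.2(i) p.23] -/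
noncomputable def preimBr (bc : A.fibreData.total.Branch) : (A.toCoveringBr bc).obj X ⟶ (A.toCoveringBr bc).obj Y :=
  preimE m (A.fibreData.total.edgeOf bc)

/-- The model functor maps `preimBr` back to the component of `m`. [cite: MochizukiSemiAnbd2006, Def. 2.2(i) p.23] -/
theorem map_preimBr (bc : A.fibreData.total.Branch) :
    (A.toBr bc).map (preimBr m bc) = m.fT (A.fibreData.total.edgeOf bc) :=
  map_preimE m (A.fibreData.total.edgeOf bc)

/-- The gluing isomorphisms of `toCovering A X` through the models, unfolded.
[cite: MochizukiSemiAnbd2006, Def. 2.2(i) p.23] -/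
theorem toCovering_obj_ψ_hom (X : Over A) (bc : A.fibreData.total.Branch) (vc : A.fibreData.total.Vertex)
    (h : A.fibreData.total.abuts bc = some vc) :
    ((A.toCovering.obj X).ψ bc vc h).hom =
      (A.gluingAt bc vc h ⋙ A.toBr bc).map
          ((Shrink.equivalence (Over ((A.vComp vc).1 : 𝒢.V (A.fibreData.proj.vertexMap vc)))).unitInv.app
            ((A.toCoveringV vc).obj X)) ≫
        (A.toBr bc).map (A.toCoveringGlueApp bc vc h X).hom :=
  rfl

/-- **Gluing compatibility on the component anabelioids**: the components of `m` satisfy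
`(b^* m_{(v,P)} ×_{b^*P} Q) ≫ glue_Y = glue_X ≫ m_{(e,Q)}` in `Over Q` — `m`'s compatibility with the
gluing isomorphisms of `B(𝒢_A)`, with the units of the model equivalences cancelled.
[cite: MochizukiSemiAnbd2006, Def. 2.2(i) p.23] -/
theorem glue_compat (bc : A.fibreData.total.Branch) (vc : A.fibreData.total.Vertex)
    (h : A.fibreData.total.abuts bc = some vc) :
    (A.gluingAt bc vc h).map (preimV m vc) ≫ (A.toCoveringGlueApp bc vc h Y).hom =
      (A.toCoveringGlueApp bc vc h X).hom ≫ preimBr m bc := by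
  have hc := m.comm bc vc h
  change (A.toBr bc).map ((A.gluingAt bc vc h).map
      ((Shrink.equivalence (Over ((A.vComp vc).1 : 𝒢.V (A.fibreData.proj.vertexMap vc)))).inverse.map
        (m.fS vc :
          (Shrink.equivalence (Over ((A.vComp vc).1 : 𝒢.V (A.fibreData.proj.vertexMap vc)))).functor.obj
              ((A.toCoveringV vc).obj X) ⟶
            (Shrink.equivalence (Over ((A.vComp vc).1 : 𝒢.V (A.fibreData.proj.vertexMap vc)))).functor.obj
              ((A.toCoveringV vc).obj Y)))) ≫
      (A.toBr bc).map ((A.gluingAt bc vc h).map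
        ((Shrink.equivalence (Over ((A.vComp vc).1 : 𝒢.V (A.fibreData.proj.vertexMap vc)))).unitInv.app
          ((A.toCoveringV vc).obj Y))) ≫
      (A.toBr bc).map (A.toCoveringGlueApp bc vc h Y).hom =
    ((A.toBr bc).map ((A.gluingAt bc vc h).map
        ((Shrink.equivalence (Over ((A.vComp vc).1 : 𝒢.V (A.fibreData.proj.vertexMap vc)))).unitInv.app
          ((A.toCoveringV vc).obj X))) ≫
      (A.toBr bc).map (A.toCoveringGlueApp bc vc h X).hom) ≫
    (m.fT (A.fibreData.total.edgeOf bc) :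
      (A.toBr bc).obj ((A.toCoveringBr bc).obj X) ⟶ (A.toBr bc).obj ((A.toCoveringBr bc).obj Y)) at hc
  rw [← map_preimV m vc, ← map_preimBr m bc, Equivalence.inv_fun_map] at hc
  simp only [Functor.map_comp, Category.assoc] at hc
  have hcancel : (A.toBr bc).map ((A.gluingAt bc vc h).map
      ((Shrink.equivalence (Over ((A.vComp vc).1 : 𝒢.V (A.fibreData.proj.vertexMap vc)))).unit.app
        ((A.toCoveringV vc).obj Y))) ≫
      (A.toBr bc).map ((A.gluingAt bc vc h).map
        ((Shrink.equivalence (Over ((A.vComp vc).1 : 𝒢.V (A.fibreData.proj.vertexMap vc)))).unitInv.app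
          ((A.toCoveringV vc).obj Y))) = 𝟙 _ := by
    rw [← Functor.map_comp, ← Functor.map_comp, Equivalence.unit, Equivalence.unitInv, Iso.hom_inv_id_app,
      CategoryTheory.Functor.map_id, CategoryTheory.Functor.map_id]
  rw [reassoc_of% hcancel] at hc
  apply (Shrink.equivalence
    (Over ((A.brComp bc).1 : 𝒢.E (𝒢.graph.edgeOf (A.fibreData.proj.branchMap bc))))).functor.map_injective
  change (A.toBr bc).map _ = (A.toBr bc).map _
  rw [Functor.map_comp, Functor.map_comp]
  exact (cancel_epi _).1 hc

end Preimage

end BObj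

end SemiGraphOfAnabelioids

end Literature.AnabelianGeometry.SemiGraphs
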